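import Mathlib
import Summits.NavierStokesRegularity.NavierStokesRegularity.Theorems.TaoLadderRungTwoFlatGappedFrontRobustClosenessOn
import Summits.NavierStokesRegularity.NavierStokesRegularity.Theorems.TaoLadderRungTwoFlatGappedFrontRobustRowSumOn
import Summits.NavierStokesRegularity.NavierStokesRegularity.Theorems.TaoLadderRungTwoFlatGappedFrontRobustSelectionOn
import Summits.NavierStokesRegularity.NavierStokesRegularity.Theorems.TaoLadderRungThreeGappedFrontRobustV2Closeness
import HarnessLib

/-!
# Shift-set pseudo-flows `PseudoFlowOnShift 𝕊`: K_B on a nearest-neighbour slot-closed `𝕊` — SELECTION OF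
  THE CONSTANTS and the closeness statement (helper for item stmt-NavierStokesRegularity-22988
  `GappedFrontRobustV2Flat`, crux K_B♭ of route TaoLadderRungTwoFlat; analogue of `gappedFrontRobustV2_closeness`)

The `𝕊`-parametrised version of `Theorems/TaoLadderRungThreeGappedFrontRobustV2Closeness.lean` (p1 g10, `S`,
`m = 4`): from `GapData₂On 𝕊` for a table in `InTableClassOn 𝕊 R` (any number `m` of modes) and the
thin-tail clause there are a margin `η > 0` and a two-piece epoch envelope `env` with admissible slack
weights AND the three closeness facts (`gappedFrontRobustV2On_closeness`). The selection is the `S` one,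
every step by a landed table-free lemma of namespace `GappedFrontRobust`, with the backscatter additions
of `…SelectionOn` (top flux absorbs `q^{5kt/2} A_top²`, bottom flux absorbs `4 Ĝ(kb)` via `Ĝ(kb) ≥ 2`,
tail start beyond a SLOWNESS threshold, closing constants from `exists_tail_closing` with `(4m, 2C₀)`).

HONEST FRAMING: a theorem about Tao-type MODEL lattice pseudo-flows (Tao 2016 §4 Lemma 4.1, §6.2–6.4) in
the cell vocabulary of `ShiftSetCascadeFlows` on a general nearest-neighbour shift set. Nothing here
concerns the Navier–Stokes equations; nothing is asserted about any table (p1 g12).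
-/

noncomputable section

-- the sub-problem namespace `Summit.NavierStokesRegularity.NavierStokesRegularity` repeats the summit name by design (D-0017)
set_option linter.dupNamespace false

namespace Summit.NavierStokesRegularity.NavierStokesRegularity.Theorems

open Set MeasureTheory intervalIntegral Literature.Analysis.FluidPDE Literature.Analysis.FluidPDE.TaoCascade

namespace GappedFrontRobustOn

variable {m : ℕ} {𝕊 : Finset (ℤ × ℤ × ℤ)}

set_option maxHeartbeats 400000 in
/-- **K_B♭ / K_B on `𝕊`, THE CLOSENESS STATEMENT (selection of the constants).** See the module docstring.
[cite: Tao2016AveragedNS, §4 Lemma 4.1 (4.5), (4.8)–(4.10); §6.2–6.4 Props. 6.3–6.5 (statement shape)] -/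
theorem gappedFrontRobustV2On_closeness (h𝕊 : IsNearestNeighbourSet 𝕊) (h𝕊c : IsSlotClosed 𝕊)
    (h111 : ((1 : ℤ), (1 : ℤ), (1 : ℤ)) ∉ 𝕊) :
    ∀ (R σ ε₀ : ℝ) (i₀ : Fin m) (α : Fin m → Fin m → Fin m → ℤ × ℤ × ℤ → ℝ) (X₀ : Fin m → ℝ)
    (Z : Set (Fin m → ℤ → ℝ)) (w : ℤ → ℝ) (r ρ θ₀ θ c₀ c : ℝ) (env₀ : ℤ → ℝ),
    InTableClassOn 𝕊 R α → 0 < ε₀ → GapData₂On 𝕊 σ ε₀ i₀ α X₀ Z w r ρ θ₀ θ c₀ c env₀ → TailThin ε₀ w r →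
      ∃ η : ℝ, 0 < η ∧ ∃ env : ℤ → ℝ,
        (∀ L : ℕ, ∃ C : ℝ, ∀ k : ℤ,
          (1 + (1 + ε₀) ^ ((10 : ℝ) * k)) * Real.sqrt (slackWeight ε₀ θ c env L k) ≤ C) ∧
        (∀ (L : ℕ) (S₀ F₀ B₀ : Fin m → ℤ → ℝ), ballDesc Z w r S₀ F₀ →
          (∀ i k, 0 ≤ B₀ i k ∧ B₀ i k ≤ η * slackWeight ε₀ θ c env L k) →
          ∀ τ : ℝ, c ≤ τ → ∀ S' F' : Fin m → ℤ → ℝ → ℝ, PseudoFlowOnShift 𝕊 τ ε₀ α η η S₀ F₀ B₀ S' F' →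
          ∀ S F : Fin m → ℤ → ℝ → ℝ,
            PseudoFlowOnShift 𝕊 c ε₀ α 0 0 S₀ (fun i k => (1 / 2) * S₀ i k ^ 2) (fun _ _ => 0) S F →
          ∀ τ₁ a : ℝ, StepTo ε₀ θ₀ c₀ i₀ (ballDesc Z w (ρ * r)) (epochEnvelope env₀) S F τ₁ a →
            (1 + σ) * a ≤ |S i₀ 1 τ₁| →
              |S' i₀ 1 τ₁ - S i₀ 1 τ₁| ≤ σ * a ∧
              (∀ i k, w k * |S' i (1 + k) τ₁ - S i (1 + k) τ₁| ≤ (1 - ρ) * r * a) ∧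
              (∀ s ∈ Icc 0 τ₁, ∀ i k, F' i k s ≤ env k)) := by
  intro R σ ε₀ i₀ α X₀ Z w r ρ θ₀ θ c₀ c env₀ hα hε hgap hthin
  obtain ⟨hgap1, hσ, ⟨C, hzC, hwC⟩, -, ⟨k₁, K₀, C₄, htail⟩⟩ := hgap
  obtain ⟨hr, hρ0, hρ1, hθ₀, hθ₀θ, hθ, hc₀, hc₀c, hw1, -, -, -, -⟩ := hgap1
  have hc : 0 < c := hc₀.trans hc₀c
  have hθ0 : 0 ≤ θ := by linarith
  have hαc : IsCancellingCoeffOn 𝕊 α := hα.2.1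
  have hα1 : ∀ (i₁ i₂ i₃ : Fin m) (μ : ℤ × ℤ × ℤ), μ ∈ 𝕊 → |α i₁ i₂ i₃ μ| ≤ 1 :=
    fun i₁ i₂ i₃ μ hμ => (hα.2.2.1 i₁ i₂ i₃ μ hμ).1
  have hmmS : 0 ≤ (m : ℝ) * m * 𝕊.card :=
    mul_nonneg (mul_nonneg (Nat.cast_nonneg m) (Nat.cast_nonneg m)) (Nat.cast_nonneg _)
  have hq : 0 < 1 + ε₀ := by linarith
  have hq1 : 1 < 1 + ε₀ := by linarith
  have hq1' : 1 ≤ 1 + ε₀ := hq1.le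
  have hw : ∀ k, 0 < w k := fun k => lt_of_lt_of_le one_pos (hw1 k)
  have hw0 : ∀ k, 0 ≤ w k := fun k => (hw k).le
  -- tameness constant
  obtain ⟨C_T, hCTdef⟩ : ∃ C_T : ℝ, C_T = max C 1 := ⟨_, rfl⟩
  have hCT : 0 < C_T := by rw [hCTdef]; exact lt_of_lt_of_le one_pos (le_max_right _ _)
  have hCC : C ≤ C_T := by rw [hCTdef]; exact le_max_left _ _
  have hzT : ∀ z ∈ Z, ∀ (i : Fin m) (k : ℤ), |z i k| ≤ C_T * (1 + (1 + ε₀) ^ (-(k : ℝ))) := by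
    intro z hz i k
    have h1 := hzC z hz i k
    have h2 : 0 ≤ 1 + (1 + ε₀) ^ (-(k : ℝ)) := by have := Real.rpow_pos_of_pos hq (-(k : ℝ)); linarith
    exact h1.trans (mul_le_mul_of_nonneg_right hCC h2)
  have hwT : ∀ k : ℤ, k ≤ 0 → w k ≤ C_T * (1 + ε₀) ^ (-(k : ℝ)) := fun k hk =>
    (hwC k hk).trans (mul_le_mul_of_nonneg_right hCC (Real.rpow_pos_of_pos hq _).le)
  -- tail threshold and clause constants
  obtain ⟨k₁', hk₁'def⟩ : ∃ k₁' : ℤ, k₁' = max k₁ 1 := ⟨_, rfl⟩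
  have hk₁'1 : 1 ≤ k₁' := by rw [hk₁'def]; exact le_max_right _ _
  have hk₁k₁' : k₁ ≤ k₁' := by rw [hk₁'def]; exact le_max_left _ _
  obtain ⟨K₀', hK₀'def⟩ : ∃ K₀' : ℝ, K₀' = max K₀ 0 := ⟨_, rfl⟩
  obtain ⟨C₄', hC₄'def⟩ : ∃ C₄' : ℝ, C₄' = max C₄ 0 := ⟨_, rfl⟩
  have hK₀'0 : 0 ≤ K₀' := by rw [hK₀'def]; exact le_max_right _ _
  have hC₄'0 : 0 ≤ C₄' := by rw [hC₄'def]; exact le_max_right _ _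
  have hT1 : ∀ k : ℤ, k₁' ≤ k → 2 * (1 + ε₀) ^ (k : ℝ) * w k ≤ w (k + 1) :=
    fun k hk => (htail k (hk₁k₁'.trans hk)).1
  have hT2 : ∀ k : ℤ, k₁' ≤ k → ∀ z ∈ Z, ∀ i : Fin m, 4 * (w k * |z i k|) ≤ r :=
    fun k hk => (htail k (hk₁k₁'.trans hk)).2.1
  have hH4a : ∀ k : ℤ, k₁' ≤ k → env₀ k ≤ K₀' * r ^ 2 / w (k - 1) ^ 2 := by
    intro k hk
    refine ((htail k (hk₁k₁'.trans hk)).2.2.1).trans ?_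
    have : K₀ ≤ K₀' := by rw [hK₀'def]; exact le_max_left _ _
    have hw2 : 0 < w (k - 1) ^ 2 := pow_pos (hw _) 2
    exact div_le_div_of_nonneg_right (mul_le_mul_of_nonneg_right this (sq_nonneg _)) hw2.le
  have hH4b : ∀ k : ℤ, k₁' ≤ k →
      (1 + ε₀) ^ ((5 : ℝ) * (k + 2) / 2) * r * w (k + 1) ≤ C₄' * w k ^ 2 := by
    intro k hk
    refine ((htail k (hk₁k₁'.trans hk)).2.2.2).trans ?_
    have : C₄ ≤ C₄' := by rw [hC₄'def]; exact le_max_left _ _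
    exact mul_le_mul_of_nonneg_right this (sq_nonneg _)
  -- the table size constant of the bond flux
  obtain ⟨C₀, hC₀def⟩ : ∃ C₀ : ℝ, C₀ = coeffAbsOn (botShifts 𝕊) α := ⟨_, rfl⟩
  have hC₀0 : 0 ≤ C₀ := by rw [hC₀def]; exact coeffAbsOn_nonneg _ _
  have h2C₀ : 0 ≤ 2 * C₀ := by positivity
  -- (1) the deviation target ψ_max
  have hq12 : 0 < (1 + ε₀) ^ (-(1 / 2 : ℝ)) := Real.rpow_pos_of_pos hq _
  obtain ⟨ψmax, hψmaxdef⟩ : ∃ ψmax : ℝ,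
      ψmax = min (min (σ * w 0 * (1 + ε₀) ^ (-(1 / 2 : ℝ)) / r) ((1 - ρ) * (1 + ε₀) ^ (-(1 / 2 : ℝ)))) 1 :=
    ⟨_, rfl⟩
  have hψmax0 : 0 < ψmax := by
    rw [hψmaxdef]
    refine lt_min (lt_min ?_ ?_) one_pos
    · have := hw 0; positivity
    · have : 0 < 1 - ρ := by linarith
      positivity
  have hψmax1 : ψmax ≤ 1 := by rw [hψmaxdef]; exact min_le_right _ _
  have hfrontT : ψmax * r ≤ σ * w 0 * (1 + ε₀) ^ (-(1 / 2 : ℝ)) := by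
    have : ψmax ≤ σ * w 0 * (1 + ε₀) ^ (-(1 / 2 : ℝ)) / r := by
      rw [hψmaxdef]; exact (min_le_left _ _).trans (min_le_left _ _)
    rwa [le_div_iff₀ hr] at this
  have hballT : ψmax ≤ (1 - ρ) * (1 + ε₀) ^ (-(1 / 2 : ℝ)) := by
    rw [hψmaxdef]; exact (min_le_left _ _).trans (min_le_right _ _)
  -- (2) the top of the front block (one-way + backscatter parts of the top flux)
  have hXtop0 : 0 ≤ C₀ * (4 * (Real.sqrt (2 * K₀') * r) + 4 * (K₀' * r ^ 2)) := by positivity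
  have hεtop : 0 < 1 / (4 * c * (C₀ * (4 * (Real.sqrt (2 * K₀') * r) + 4 * (K₀' * r ^ 2))) + 4) := by
    positivity
  obtain ⟨kt, hk₁t, hkt1, hkt⟩ := GappedFrontRobust.exists_top_shell hq1 hw hT1 hεtop
  have htopflux : c * ((1 + ε₀) ^ ((5 : ℝ) * kt / 2) * C₀ *
      (4 * (Real.sqrt (2 * K₀') * r / w kt) + 2 * (Real.sqrt (2 * K₀') * r / w kt) ^ 2)) ≤ 1 / 4 :=
    topflux_of_top_shell hq hc hC₀0 hK₀'0 hr (hw1 kt) (hkt kt le_rfl)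
  -- (3) the block start scale E⋆ and the neighbour constant C₁
  obtain ⟨Estar, hEdef⟩ : ∃ Estar : ℝ,
      Estar = 1 / 2 * (m : ℝ) * (2 * C_T + r) ^ 2 * (1 + ε₀) ^ ((2 : ℝ) * kt) / ((1 + ε₀) ^ 2 - 1) :=
    ⟨_, rfl⟩
  have hq21 : 0 < (1 + ε₀) ^ 2 - 1 := by nlinarith
  have hE0 : 0 ≤ Estar := by
    rw [hEdef]; have := Real.rpow_pos_of_pos hq ((2 : ℝ) * kt); positivity
  have hEstar : 1 / 2 * (m : ℝ) * (2 * C_T + r) ^ 2 * (1 + ε₀) ^ ((2 : ℝ) * kt) / ((1 + ε₀) ^ 2 - 1) ≤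
      Estar := by rw [hEdef]
  obtain ⟨C₁, hC₁def⟩ : ∃ C₁ : ℝ, C₁ = 6 * (C_T + r) * (1 + ε₀) + 2 * Real.sqrt (2 * Estar + 2) := ⟨_, rfl⟩
  have hC₁ : 6 * (C_T + r) * (1 + ε₀) + 2 * Real.sqrt (2 * Estar + 2) ≤ C₁ := by rw [hC₁def]
  -- (4) the bottom of the front block (one-way + backscatter parts of the bottom flux)
  have hCG0 : 0 < C_T + r := by positivity
  obtain ⟨kb₁, hkb₁, hdrift₁⟩ := GappedFrontRobust.exists_kb_behind_condition' (C₁ := C₁)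
    (Cα := (m : ℝ) * m * 𝕊.card) hq1 hCG0 hc.le hmmS
  obtain ⟨kb₂, hkb₂, hbot₂⟩ := GappedFrontRobust.exists_kb_bottom_flux (C₁ := C₁) hq1 hc.le h2C₀
  obtain ⟨kb, hkbdef⟩ : ∃ kb : ℤ, kb = min kb₁ kb₂ := ⟨_, rfl⟩
  have hkbkb₁ : kb ≤ kb₁ := by rw [hkbdef]; exact min_le_left _ _
  have hkbkb₂ : kb ≤ kb₂ := by rw [hkbdef]; exact min_le_right _ _
  have hkb : kb ≤ -1 := hkbkb₁.trans hkb₁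
  have hdrift : ∀ n : ℤ, n ≤ kb →
      c * (2 * ((m : ℝ) * m * 𝕊.card) * (1 + ε₀) ^ ((5 : ℝ) * n / 2) *
        (C₁ * (1 + ε₀) ^ (-(n : ℝ))) * (C₁ * (1 + ε₀) ^ (-(n : ℝ)))) ≤
        (C_T + r) * (1 + (1 + ε₀) ^ (-(n : ℝ))) / 2 := fun n hn => hdrift₁ n (hn.trans hkbkb₁)
  have hbot : c * ((1 + ε₀) ^ ((5 : ℝ) * kb / 2) * C₀ *
      (2 * (C₁ * (1 + ε₀) ^ (-(kb : ℝ))) ^ 2 + 4 * (C₁ * (1 + ε₀) ^ (-(kb : ℝ))))) ≤ 1 / 4 := by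
    have hkbr : (kb : ℝ) ≤ -1 := by exact_mod_cast hkb
    have hqkb : 1 ≤ (1 + ε₀) ^ (-(kb : ℝ)) := Real.one_le_rpow hq1' (by linarith)
    have hCT1 : 1 ≤ C_T := by rw [hCTdef]; exact le_max_right _ _
    have hC₁2 : 2 ≤ C₁ := by
      have : 0 ≤ 2 * Real.sqrt (2 * Estar + 2) := by positivity
      have h6 : 1 ≤ (C_T + r) * (1 + ε₀) := one_le_mul_of_one_le_of_one_le (by linarith) hq1'
      rw [hC₁def]; linarith
    have hG2 : 2 ≤ C₁ * (1 + ε₀) ^ (-(kb : ℝ)) := by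
      have := mul_le_mul hC₁2 hqkb zero_le_one (by linarith : (0 : ℝ) ≤ C₁); linarith
    exact botflux_of_two_le hq hc.le hC₀0 hG2 (hbot₂ kb hkbkb₂)
  -- (5) the exact flow's envelope shape and the tolerance scale
  obtain ⟨A₀, hA₀def⟩ : ∃ A₀ : ℤ → ℝ, A₀ = fun k =>
      if k ≤ kb then 2 * ((C_T + r) * (1 + (1 + ε₀) ^ (-(k : ℝ))))
      else if k ≤ kt then Real.sqrt (2 * (2 * Estar * (1 + ε₀) ^ (-(2 : ℝ) * kb) + 2))
      else Real.sqrt (2 * K₀') * r / w (k - 1) := ⟨_, rfl⟩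
  obtain ⟨D, hDdef⟩ : ∃ D : ℤ → ℝ, D = fun k => r / w (k - 1) := ⟨_, rfl⟩
  have hD : ∀ k, D k = r / w (k - 1) := fun k => by rw [hDdef]
  obtain ⟨hA0, hA₀lo, hA₀mid, hA₀hi, hA_lo, hA_mid, hA_hi⟩ :=
    GappedFrontRobust.A0_shape hε hr hCT hE0 hw1 hkb hkt1 hA₀def
  obtain ⟨C_A, hCAdef⟩ : ∃ C_A : ℝ, C_A = 4 * (C_T + r) + 2 * Real.sqrt (Estar + 1) * (1 + ε₀) ^ (2 : ℝ) :=
    ⟨_, rfl⟩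
  have hCA0 : 0 ≤ C_A := by rw [hCAdef]; have := Real.rpow_pos_of_pos hq (2 : ℝ); positivity
  obtain ⟨A_mid, hAmiddef⟩ : ∃ A_mid : ℝ,
      A_mid = Real.sqrt (2 * (2 * Estar * (1 + ε₀) ^ (-(2 : ℝ) * kb) + 2)) + Real.sqrt (2 * K₀') * r :=
    ⟨_, rfl⟩
  have hAmid0 : 0 ≤ A_mid := by rw [hAmiddef]; positivity
  rw [← hCAdef] at hA_lo
  rw [← hAmiddef] at hA_mid
  -- the finite weight maxima
  obtain ⟨W, hWdef⟩ : ∃ W : ℝ, W = ∑ j ∈ Finset.Icc (kb + 1) (kt + 1), w j := ⟨_, rfl⟩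
  have hW : ∀ j : ℤ, kb + 1 ≤ j → j ≤ kt + 1 → w j ≤ W := fun j hj hj' => by
    rw [hWdef]; exact GappedFrontRobust.le_sum_Icc_of_mem hw0 hj hj'
  have hW0 : 0 < W := lt_of_lt_of_le (hw (kt + 1)) (hW (kt + 1) (by linarith only [hkb, hkt1]) le_rfl)
  -- (6) the row-sum constant Γ
  obtain ⟨Γ, hΓdef⟩ : ∃ Γ : ℝ, Γ = 2 * ((m : ℝ) * m * 𝕊.card) *
      ((C_A + 2 * r) * C_T * (1 + ε₀) ^ (3 : ℝ) +
        (1 + ε₀) ^ ((5 : ℝ) * ((kt + 2 : ℤ) : ℝ) / 2) * (A_mid + 2 * r) * W + (Real.sqrt (2 * K₀') + 2) * C₄') +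
      1 := ⟨_, rfl⟩
  have hΓ : 0 < Γ := by
    rw [hΓdef]
    have h3 := Real.rpow_pos_of_pos hq (3 : ℝ); have h5 := Real.rpow_pos_of_pos hq ((5 : ℝ) * ((kt + 2 : ℤ) : ℝ) / 2)
    have hin : 0 ≤ (C_A + 2 * r) * C_T * (1 + ε₀) ^ (3 : ℝ) +
        (1 + ε₀) ^ ((5 : ℝ) * ((kt + 2 : ℤ) : ℝ) / 2) * (A_mid + 2 * r) * W +
          (Real.sqrt (2 * K₀') + 2) * C₄' := by positivity
    have := mul_nonneg (mul_nonneg zero_le_two hmmS) hin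
    linarith
  have hrow : ∀ P : ℝ, 0 ≤ P → P ≤ 1 → ∀ (i : Fin m) (n : ℤ),
      ∑ i₁, ∑ i₂, ∑ μ ∈ 𝕊, |α i₁ i₂ i μ| * (1 + ε₀) ^ ((5 : ℝ) * (n - μ.2.2) / 2) *
        (D (n - μ.2.2 + μ.1) * (A₀ (n - μ.2.2 + μ.2.1) + 2 * P * D (n - μ.2.2 + μ.2.1)) +
          (A₀ (n - μ.2.2 + μ.1) + 2 * P * D (n - μ.2.2 + μ.1)) * D (n - μ.2.2 + μ.2.1)) ≤ Γ * D n := by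
    intro P hP0 hP1 i n
    rw [hΓdef]
    exact rowSumOn_le_gamma h𝕊 hε hα1 hw1 hCT hwT hk₁'1 hk₁t hkb hT1 hr hC₄'0 hH4b hD hA0 hCA0 hAmid0
      (Real.sqrt_nonneg _) hW0 hA_lo (fun k hk _ => hA_mid k hk) hA_hi hW hP0 hP1 i n
  -- (7) the profile and the tail target
  obtain ⟨ψ₀, hψ₀def⟩ : ∃ ψ₀ : ℝ, ψ₀ = ψmax * Real.exp (-(4 * Γ * c)) := ⟨_, rfl⟩
  have hψ₀ : 0 < ψ₀ := by rw [hψ₀def]; positivity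
  have hψ₀max : ψ₀ * Real.exp (4 * Γ * c) ≤ ψmax := by
    rw [hψ₀def, mul_assoc, ← Real.exp_add, neg_add_cancel, Real.exp_zero, mul_one]
  obtain ⟨ν, hν⟩ : ∃ ν : ℝ, ν = ψ₀ / 2 := ⟨_, rfl⟩
  have hν0 : 0 < ν := by rw [hν]; positivity
  -- (8) the tail: closing constants (with the backscatter factor 2), thin-tail, decay and slowness
  -- thresholds, the tail start k₂
  have hν₀0 : 0 ≤ Real.sqrt (2 * K₀') + 2 * ψmax := by positivity
  have hm0 : (0 : ℝ) ≤ 4 * (m : ℝ) := by positivity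
  obtain ⟨ϑ, β₀, hϑ, hβ₀, K₀'', hcloseK⟩ := GappedFrontRobust.exists_tail_closing (mR := 4 * (m : ℝ))
    (C := 2 * C₀) hq1 hν0 hν₀0 hm0 h2C₀ hc.le
  obtain ⟨kth, hkth⟩ := GappedFrontRobust.tailThin_shifted hthin hϑ
  obtain ⟨J, A', hA', hJ⟩ := GappedFrontRobust.rpow_le_mul_weight_of_T1 hq1' hw hT1 (11 : ℝ)
  obtain ⟨Mx, hMxdef⟩ : ∃ Mx : ℝ, Mx = Real.sqrt (2 * K₀') + 2 * ψmax + ν := ⟨_, rfl⟩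
  have hMx0 : 0 ≤ Mx := by rw [hMxdef]; positivity
  have hq52 : 0 < (1 + ε₀) ^ ((5 : ℝ) / 2) := Real.rpow_pos_of_pos hq _
  have hεslow : 0 < 1 / (2 * ((1 + ε₀) ^ ((5 : ℝ) / 2) * C₀ * c * Mx * r) + 2) := by positivity
  obtain ⟨ks, -, -, hks⟩ := GappedFrontRobust.exists_top_shell hq1 hw hT1 hεslow
  obtain ⟨k₂, hk₂def⟩ : ∃ k₂ : ℤ,
      k₂ = max (max K₀'' kth) (max (k₁' + 1) (max 3 (max (J + 1) (ks + 2)))) := ⟨_, rfl⟩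
  have hk₂K : K₀'' ≤ k₂ := by rw [hk₂def]; exact (le_max_left _ _).trans (le_max_left _ _)
  have hk₂th : kth ≤ k₂ := by rw [hk₂def]; exact (le_max_right _ _).trans (le_max_left _ _)
  have hk₂k₁ : k₁' ≤ k₂ - 1 := by
    have : k₁' + 1 ≤ k₂ := by rw [hk₂def]; exact (le_max_left _ _).trans (le_max_right _ _)
    linarith
  have hk₂3 : 3 ≤ k₂ := by
    rw [hk₂def]; exact ((le_max_left _ _).trans (le_max_right _ _)).trans (le_max_right _ _)
  have hk₂J : J + 1 ≤ k₂ := by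
    rw [hk₂def]
    exact (((le_max_left _ _).trans (le_max_right _ _)).trans (le_max_right _ _)).trans (le_max_right _ _)
  have hk₂s : ks + 2 ≤ k₂ := by
    rw [hk₂def]
    exact (((le_max_right _ _).trans (le_max_right _ _)).trans (le_max_right _ _)).trans (le_max_right _ _)
  have hthin' : ∀ K : ℤ, k₂ ≤ K → (1 + ε₀) ^ ((5 : ℝ) * K / 2) * r * w (K - 1) ≤ ϑ * w (K - 2) ^ 2 :=
    fun K hK => hkth K (hk₂th.trans hK)
  have hclose : ∀ β : ℝ, 0 ≤ β → β ≤ β₀ → ∀ K : ℤ, k₂ ≤ K → ∀ x : ℝ,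
      (x = Real.sqrt (2 * K₀') + 2 * ψmax ∨ x = ν) →
      2 * (Real.sqrt 2 * Real.sqrt (4 / 3 * m * (25 / 32 + β * (1 + ε₀) ^ ((2 : ℝ) * K))) /
          (2 * (1 + ε₀) ^ ((K - 1 : ℤ) : ℝ)) +
        C₀ * c * (ϑ / (1 + ε₀) ^ ((5 : ℝ) / 2)) * x ^ 2) ≤ ν := by
    intro β hβ hββ₀ K hK x hx
    have h1 := hcloseK β hβ hββ₀ K (hk₂K.trans hK) x hx
    have h2 := two_mul_close_of (m := (m : ℝ)) (C := C₀) (ν := ν)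
      (e := c * ((ϑ / (1 + ε₀) ^ ((5 : ℝ) / 2)) * x ^ 2)) (d := 2 * (1 + ε₀) ^ ((K - 1 : ℤ) : ℝ))
      (X := 25 / 32 + β * (1 + ε₀) ^ ((2 : ℝ) * K)) (by simpa only [mul_assoc] using h1)
    simpa only [mul_assoc] using h2
  have hslow : ∀ K : ℤ, k₂ ≤ K → ∀ x : ℝ, (x = Real.sqrt (2 * K₀') + 2 * ψmax ∨ x = ν) →
      (1 + ε₀) ^ ((5 : ℝ) * (K - 1 : ℤ) / 2) * C₀ * c * (x * r / w (K - 2)) ≤ 1 / 2 := by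
    intro K hK x hx
    have hx0 : 0 ≤ x := by rcases hx with rfl | rfl <;> [exact hν₀0; exact hν0.le]
    have hxM : x ≤ Mx := by rcases hx with rfl | rfl <;> (rw [hMxdef]; linarith)
    exact slow_of_top_shell hq hc.le hC₀0 hMx0 hr.le hx0 hxM (hks (K - 2) (by linarith))
  have hJ' : ∀ j : ℤ, k₂ - 1 ≤ j → (1 + ε₀) ^ ((11 : ℝ) * j) ≤ A' * w j :=
    fun j hj => hJ j (by linarith only [hj, hk₂J])
  -- (9) the uniform device: A_unif, E_env, the weight maxima W₂ and Ω
  have hAunif : ∀ n : ℤ, A₀ n ≤ (C_A + A_mid) * (1 + (1 + ε₀) ^ (-(n : ℝ))) :=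
    GappedFrontRobust.A0_le_unif hq hCA0 hAmid0 hA_lo hA_mid
  have hAu0 : 0 ≤ C_A + A_mid := add_nonneg hCA0 hAmid0
  obtain ⟨E_env, hEenvdef⟩ : ∃ E_env : ℝ, E_env = 6 * (C_A + A_mid + 2 * r) ^ 2 + 12 := ⟨_, rfl⟩
  have hEenv0 : 0 ≤ E_env := by rw [hEenvdef]; positivity
  obtain ⟨W₂, hW₂def⟩ : ∃ W₂ : ℝ, W₂ = ∑ j ∈ Finset.Icc 0 k₂, w j := ⟨_, rfl⟩
  have hW₂ : ∀ j : ℤ, 0 ≤ j → j ≤ k₂ → w j ≤ W₂ := fun j hj hj' => by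
    rw [hW₂def]; exact GappedFrontRobust.le_sum_Icc_of_mem hw0 hj hj'
  have hW₂0 : 0 ≤ W₂ := by rw [hW₂def]; exact Finset.sum_nonneg fun j _ => hw0 j
  have hΩ : ∀ s : ℝ, 1 ≤ s → ∀ n : ℤ, n < k₂ →
      (1 + ε₀) ^ (s * n) * w (n - 1) ≤ C_T * (1 + ε₀) + (1 + ε₀) ^ (s * k₂) * W₂ :=
    fun s hs n hn => GappedFrontRobust.rpow_mul_weight_le hq1' hCT.le hW₂0 hs hw0 hwT hW₂ hn
  have hΩs0 : ∀ s : ℝ, 0 ≤ C_T * (1 + ε₀) + (1 + ε₀) ^ (s * k₂) * W₂ := fun s => by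
    have := Real.rpow_pos_of_pos hq (s * k₂); positivity
  have hΩ₁ : ∀ n : ℤ, n < k₂ → (1 + ε₀) ^ ((1 : ℝ) * n) * w (n - 1) ≤
      C_T * (1 + ε₀) + (1 + ε₀) ^ ((1 : ℝ) * k₂) * W₂ := hΩ 1 le_rfl
  have hΩ₂ : ∀ n : ℤ, n < k₂ → (1 + ε₀) ^ ((2 : ℝ) * n) * w (n - 1) ≤
      C_T * (1 + ε₀) + (1 + ε₀) ^ ((2 : ℝ) * k₂) * W₂ := hΩ 2 (by norm_num)
  have hΩ₅ : ∀ n : ℤ, n < k₂ → (1 + ε₀) ^ ((5 : ℝ) * n / 2) * w (n - 1) ≤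
      C_T * (1 + ε₀) + (1 + ε₀) ^ ((5 / 2 : ℝ) * k₂) * W₂ := by
    intro n hn
    have := hΩ (5 / 2) (by norm_num) n hn
    rwa [show (5 / 2 : ℝ) * n = (5 : ℝ) * n / 2 by ring] at this
  -- (10) the envelope and its slack bounds
  obtain ⟨env, henvdef⟩ : ∃ env : ℤ → ℝ, env = fun j =>
      if j < k₂ then E_env * (1 + ε₀) ^ ((2 : ℝ) * (k₂ - j)) else 1 * r ^ 2 / w (j - 1) ^ 2 := ⟨_, rfl⟩
  have hlo : ∀ j : ℤ, j < k₂ → env j = E_env * (1 + ε₀) ^ ((2 : ℝ) * (k₂ - j)) := fun j hj => by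
    rw [henvdef]; simp only [hj, if_true]
  have hhi : ∀ j : ℤ, k₂ ≤ j → env j = 1 * r ^ 2 / w (j - 1) ^ 2 := fun j hj => by
    rw [henvdef]; simp only [show ¬ (j < k₂) from not_lt.mpr hj, if_false]
  have henv_lo : ∀ k : ℤ, k < k₂ → E_env * (1 + ε₀) ^ ((2 : ℝ) * (k₂ - k)) ≤ env k :=
    fun k hk => (hlo k hk).symm.le
  have henv_hi : ∀ k : ℤ, k₂ ≤ k → r ^ 2 / w (k - 1) ^ 2 ≤ env k := fun k hk => by rw [hhi k hk, one_mul]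
  obtain ⟨hSWtail, hSWlow⟩ := GappedFrontRobust.two_piece_slackWeight_le (θ := θ) (c := c) hε hθ0 hθ hc.le
    hEenv0 zero_le_one
    hw hT1 (by linarith only [hk₂k₁] : k₁' + 1 ≤ k₂) hk₂3 hlo hhi
  obtain ⟨Csw, hCswdef⟩ : ∃ Csw : ℝ, Csw =
      c * E_env * (1 + ε₀) ^ ((2 : ℝ) * k₂) * ((1 + ε₀) ^ (1 / 2 + θ)) ^ (k₂ : ℝ) /
          ((1 + ε₀) ^ (1 / 2 + θ) - 1) +
        ((1 + ε₀) ^ (1 / 2 + θ)) ^ (((k₂ - 1 : ℤ)) : ℝ) *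
          (2 * c * (1 + ε₀) ^ (5 / 2 + θ) * 1 *
            ((1 + ε₀) ^ ((2 : ℝ) * ((k₂ - 1 : ℤ) : ℝ)) * r ^ 2 / w (k₂ - 1) ^ 2)) := ⟨_, rfl⟩
  have hx1 : 1 < (1 + ε₀) ^ (1 / 2 + θ) := Real.one_lt_rpow hq1 (by linarith only [hθ0])
  have hx0 : 0 < (1 + ε₀) ^ (1 / 2 + θ) := by linarith only [hx1]
  have hCsw0 : 0 ≤ Csw := by
    rw [hCswdef]
    have := Real.rpow_pos_of_pos hq ((2 : ℝ) * k₂); have := Real.rpow_pos_of_pos hx0 (k₂ : ℝ)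
    have := Real.rpow_pos_of_pos hx0 (((k₂ - 1 : ℤ)) : ℝ); have := Real.rpow_pos_of_pos hq (5 / 2 + θ)
    have := Real.rpow_pos_of_pos hq ((2 : ℝ) * ((k₂ - 1 : ℤ) : ℝ)); have := hw (k₂ - 1)
    have hxm : 0 < (1 + ε₀) ^ (1 / 2 + θ) - 1 := by linarith only [hx1]
    positivity
  have hSWlow' : ∀ (L : ℕ) (k : ℤ), k ≤ k₂ - 1 → slackWeight ε₀ θ c env L k ≤
      Csw * (1 + ε₀) ^ (-((1 / 2 + θ) * k)) := fun L k hk => by rw [hCswdef]; exact hSWlow L k hk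
  have hdec := GappedFrontRobust.two_piece_slackDecay (θ := θ) hε hc.le hEenv0 zero_le_one hw
    (by linarith only [hk₂3] : (1 : ℤ) ≤ k₂) hA'
    hJ' hlo hhi
  -- (11) the margin η
  obtain ⟨Ω₁, hΩ₁def⟩ : ∃ Ω₁ : ℝ, Ω₁ = C_T * (1 + ε₀) + (1 + ε₀) ^ ((1 : ℝ) * k₂) * W₂ := ⟨_, rfl⟩
  have hΩ₁0 : 0 ≤ Ω₁ := by rw [hΩ₁def]; exact hΩs0 1
  have hΩ₁' : ∀ n : ℤ, n < k₂ → (1 + ε₀) ^ ((1 : ℝ) * n) * w (n - 1) ≤ Ω₁ := fun n hn => by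
    rw [hΩ₁def]; exact hΩ₁ n hn
  have hX1 : 0 ≤ (1 + ε₀) ^ ((2 : ℝ) * k₂) * c := by
    have := Real.rpow_pos_of_pos hq ((2 : ℝ) * k₂); positivity
  have hX2 : 0 ≤ 2 * c * (1 + ε₀) ^ (5 / 2 + θ) * 1 := by
    have := Real.rpow_pos_of_pos hq (5 / 2 + θ); positivity
  have hX4 : 0 ≤ 4 * c * Real.sqrt (6 * (C_A + A_mid + 2 * r) ^ 2 + 12) * (1 + ε₀) ^ (k₂ : ℝ) * Ω₁ := by
    have := Real.rpow_pos_of_pos hq (k₂ : ℝ); positivity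
  obtain ⟨η, hηdef⟩ : ∃ η : ℝ, η =
      min (min (1 / ((1 + ε₀) ^ ((2 : ℝ) * k₂) * c + 1)) (β₀ / (2 * c * (1 + ε₀) ^ (5 / 2 + θ) * 1 + 1)))
        (min (1 / (Csw + 1))
          (ψ₀ * r / (4 * c * Real.sqrt (6 * (C_A + A_mid + 2 * r) ^ 2 + 12) * (1 + ε₀) ^ (k₂ : ℝ) * Ω₁ + 1))) :=
    ⟨_, rfl⟩
  have hη : 0 < η := by
    rw [hηdef]
    refine lt_min (lt_min ?_ ?_) (lt_min ?_ ?_)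
    · exact div_pos one_pos (by linarith only [hX1])
    · exact div_pos hβ₀ (by linarith only [hX2])
    · exact div_pos one_pos (by linarith only [hCsw0])
    · exact div_pos (mul_pos hψ₀ hr) (by linarith only [hX4])
  have hηg : η * (1 + ε₀) ^ ((2 : ℝ) * k₂) * c ≤ 1 := by
    rw [mul_assoc]
    refine GappedFrontRobust.mul_le_of_le_div_add_one hX1 hη.le ?_
    rw [hηdef]; exact (min_le_left _ _).trans (min_le_left _ _)
  have hηβ : η * (2 * c * (1 + ε₀) ^ (5 / 2 + θ) * 1) ≤ β₀ := by
    refine GappedFrontRobust.mul_le_of_le_div_add_one hX2 hη.le ?_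
    rw [hηdef]; exact (min_le_left _ _).trans (min_le_right _ _)
  have hηC : η * Csw ≤ 1 := by
    refine GappedFrontRobust.mul_le_of_le_div_add_one hCsw0 hη.le ?_
    rw [hηdef]; exact (min_le_right _ _).trans (min_le_left _ _)
  have hηψ : η * (4 * c * Real.sqrt (6 * (C_A + A_mid + 2 * r) ^ 2 + 12) * (1 + ε₀) ^ (k₂ : ℝ) * Ω₁) ≤
      ψ₀ * r := by
    refine GappedFrontRobust.mul_le_of_le_div_add_one hX4 hη.le ?_
    rw [hηdef]; exact (min_le_right _ _).trans (min_le_right _ _)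
  -- (12) the per-shell budgets
  have hθ32 : θ ≤ 3 / 2 := by linarith only [hθ]
  have hk₂0 : 0 ≤ k₂ := by linarith only [hk₂3]
  have hD2 : ∀ n : ℤ, n < k₂ →
      3 * ((A₀ n + 2 * ψmax * D n) ^ 2 / 2 + η * (Csw * (1 + ε₀) ^ (-((1 / 2 + θ) * n)))) ≤
        E_env * (1 + ε₀) ^ ((2 : ℝ) * (k₂ - n)) := by
    intro n hn
    rw [hEenvdef]
    exact GappedFrontRobust.budget_envelope hq1' hr.le hθ0 hθ32 hψmax0.le hψmax1 hηC hk₂0 hw1 hD hA0 hAunif hn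
  have hD1 : ∀ n : ℤ, n < k₂ →
      c * (η * (1 + ε₀) ^ ((2 : ℝ) * n) *
        Real.sqrt (3 * ((A₀ n + 2 * ψmax * D n) ^ 2 / 2 + η * (Csw * (1 + ε₀) ^ (-((1 / 2 + θ) * n)))))) ≤
        ψ₀ * D n / 4 := fun n hn =>
    GappedFrontRobust.budget_defect hq1' hr.le hθ0 hθ32 hψmax0.le hψmax1 hη.le hηC hk₂0 hw1 hD hA0 hAunif
      hc.le hΩ₁' hηψ hn
  -- conclude
  rw [hC₀def] at hbot htopflux hclose hslow
  refine ⟨η, hη, env, hdec, ?_⟩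
  exact stepCloseness_core h𝕊 h𝕊c h111 hε hαc hα1 hr hρ1.le hc hc₀c.le (by linarith only [hθ₀θ, hθ]) hw1
    hCT hzT hK₀'0 hT1 hT2 hH4a
    hk₁t hkt1 hkb hEstar hE0 hC₁ hdrift hbot htopflux hD hA₀lo hA₀mid hA₀hi hΓ hψ₀ hψmax1 hψ₀max hν hrow
    hfrontT hballT hk₂k₁ (by linarith only [hk₂3]) hβ₀.le hthin' hclose hslow henv_hi henv_lo hSWtail
    hSWlow' hη hηg hηβ hD2 hD1
    (hΩs0 _) (hΩs0 _) hΩ₅ hΩ₂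

end GappedFrontRobustOn

end Summit.NavierStokesRegularity.NavierStokesRegularity.Theorems

end
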